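import Literature.IUT.LogVolume.WildQuadraticIsometryMover
import Literature.IUT.LogVolume.UnitLogWildDyadic
import HarnessLib

/-!
# A wild dyadic isometry MOVING the maximal order of a tensor packet at every `K ⊇ ℚ₂(√−1)` with residue field `≠ 𝔽₂`:
# the UNIT TWIST `1 ↦ 1`, `(1 − i) ↦ u·(1 − i)`

Classical local algebra (nothing disputed; the [IUTchIV] locator records where the abc-iut cell uses it).  [IUTchIV]
Prop. 1.1 p. 9: the maximal `ℤ_p`-order `(R_I)^∼` of a tensor packet (the tree's `normalizedPacket`; its points have all
field-factor coordinates of norm `≤ 1`).  `WildCubicIsometryMover` (`ℚ₃(∛3)`, reflection) and `WildQuadraticIsometryMover`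
(`ℚ₂(√2)`, transvection) exhibit factorwise `ℚ_p`-linear ISOMETRIES moving `(R_I)^∼`; neither field is a completion of a
number field containing `√−1`.  THIS FILE: ANY field `K` (normed `ℚ₂`-algebra) with `i ∈ K`, `i² = −1`, and ANY `u ∈ K`
with `‖u‖ ≤ 1`, `‖1 − u‖ = 1` (a unit of residue `≠ 1`: exists iff the residue field is not `𝔽₂`; e.g. `ζ₃`, `ζ_l`).
* `gaussIdempotent_mem_normalizedPacket`: `x := ½·(1⊗1 − i⊗i)` is an idempotent of `K ⊗_{ℚ₂} K`, so `x ∈ (R_I)^∼`;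
* `congr_pair_gaussIdempotent`: for ANY `ℚ₂`-linear `f₀, f₁` with `f₀ 1 = 1`, `f₀ i = 1 − u + u·i` (equivalently
  `f₀ (1 − i) = u·(1 − i)`: the UNIT TWIST) and `f₁` fixing `1, i`: `(f₀ ⊗ f₁)(x) = ½·(1⊗1 − (1 − u + u i)⊗i)`;
* **`one_lt_norm_dEquiv_twistedIdempotent`**: EVERY field-factor coordinate of that image has norm `2‖1 ∓ i‖ = √2 > 1` —
  a coordinate of `V ≅ Π_j L_j` on the two slots is a pair of isometric field maps `a, b : K → L_j` with `b(i) = ±a(i)`, and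
  the coordinate is `a(½((1+u) − (1−u)i))` resp. `a(½(1−u)(1+i))`, where `(1+u) − (1−u)i = 2u + (1−u)(1−i)` has norm
  `‖1 − i‖` (isosceles: `‖2u‖ ≤ ½ < ‖1 − i‖ = 2^{−1/2}`).  No dual basis, no Galois expansion, no degree hypothesis;
  hence `…_not_mem`, `exists_mem_normalizedPacket_congr_not_mem`, `congr_image_normalizedPacket_ne`;
* **`norm_add_mul_eq_max_of_zpow`** (PARITY: `‖a + b(1 − i)‖ = max(‖a‖, ‖b‖‖1 − i‖)` for `‖a‖, ‖b‖ ∈ 2^ℤ ∪ {0}`) and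
  **`exists_unitTwist_isometry`**: on the class `K = W₀ ⊕ W₀·(1 − i)`, `W₀ ∋ 1` a `ℚ₂`-subspace with `‖W₀ ∖ 0‖ ⊆ 2^ℤ`
  (= `e(K | ℚ₂(√−1)) = 1`, ANY residue degree; `W₀` the maximal unramified subfield: `ℚ₂(ζ₁₂) = ℚ₂(ζ₃) ⊕ ℚ₂(ζ₃)(1 − i)`,
  `ℚ₂(ζ_l, √−1)`, …) and `‖u‖ = 1`, the twist `g = id` on `W₀`, `× u` on `W₀(1 − i)` is a `ℚ₂`-linear ISOMETRY with
  `g 1 = 1`, `g i = 1 − u + u i`; **`exists_isometry_maxOrder_mover`** packages it in the shape of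
  `WildCubicIsometryMover.exists_isometry_maxOrder_mover`, ready for `IsometryMoverAscent` (every `K′ ⊇ K`).
Use (abc-iut cell, R-J rows Y-26 / Y-29b): the dyadic print-shaped class (`√−1 ∈ F`, [IUTchI] Def. 3.1 (a)).  CONTAINERS
only; no side taken on [IUTchIII] Cor. 3.12.  Proof-only file; Literature-side support for the block-E adversary lane's
`ℚ₂(ζ₁₂)` exhibit (a different mover: diagonal unit twist, not a unit-layer shear).
[cite: Mochizuki2012, IUTchIV Prop. 1.1 p. 9, Prop. 1.4 (i) p. 13] [cite: NeukirchANT1999, Ch. II (4.8), (5.5)]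
[cite: WeilBNT1967, Ch. II §1, Prop. 2–3]
-/


noncomputable section

open Metric Set
open scoped TensorProduct Pointwise

namespace Literature.IUT.LogVolume

namespace WildGaussian

variable {K : Type} [NontriviallyNormedField K] [NormedAlgebra ℚ_[2] K]
variable {i u : K}

/-! ## §1 Absolute values in `K ⊇ ℚ₂(i)`, `i² = −1` -/

omit [NormedAlgebra ℚ_[2] K] in
/-- `‖i‖ = 1` (`i² = −1`). [cite: NeukirchANT1999, Ch. II (4.8)] -/
theorem norm_i (hi : i ^ 2 = -1) : ‖i‖ = 1 := by
  have h : ‖i‖ ^ 2 = 1 := by rw [← norm_pow, hi, norm_neg, norm_one]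
  exact (pow_left_inj₀ (norm_nonneg i) zero_le_one two_ne_zero).mp (by rw [h, one_pow])

/-- `‖1 − i‖² = ½` (`(1 − i)² = −2i`). [cite: NeukirchANT1999, Ch. II (4.8)] -/
theorem norm_one_sub_i_sq (hi : i ^ 2 = -1) : ‖1 - i‖ ^ 2 = 2⁻¹ := by
  have h : (1 - i) ^ 2 = -(2 * i) := by linear_combination hi
  rw [← norm_pow, h, norm_neg, norm_mul, WildDyadic.norm_two, norm_i hi, mul_one]

/-- `‖1 + i‖² = ½` (`(1 + i)² = 2i`). [cite: NeukirchANT1999, Ch. II (4.8)] -/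
theorem norm_one_add_i_sq (hi : i ^ 2 = -1) : ‖1 + i‖ ^ 2 = 2⁻¹ := by
  have h : (1 + i) ^ 2 = 2 * i := by linear_combination hi
  rw [← norm_pow, h, norm_mul, WildDyadic.norm_two, norm_i hi, mul_one]

/-- `½ < ‖1 − i‖` (`¼ < ½ = ‖1 − i‖²`). [cite: NeukirchANT1999, Ch. II (4.8)] -/
theorem two_inv_lt_norm_one_sub_i (hi : i ^ 2 = -1) : (2 : ℝ)⁻¹ < ‖1 - i‖ := by
  refine lt_of_pow_lt_pow_left₀ 2 (norm_nonneg _) ?_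
  rw [norm_one_sub_i_sq hi]
  norm_num

/-- `1 < 2·‖1 − i‖` (its square is `2`). [cite: NeukirchANT1999, Ch. II (4.8)] -/
theorem one_lt_two_mul_norm_one_sub_i (hi : i ^ 2 = -1) : 1 < 2 * ‖1 - i‖ := by
  refine lt_of_pow_lt_pow_left₀ 2 (by positivity) ?_
  rw [mul_pow, norm_one_sub_i_sq hi]
  norm_num

/-- `1 < 2·‖1 + i‖` (its square is `2`). [cite: NeukirchANT1999, Ch. II (4.8)] -/
theorem one_lt_two_mul_norm_one_add_i (hi : i ^ 2 = -1) : 1 < 2 * ‖1 + i‖ := by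
  refine lt_of_pow_lt_pow_left₀ 2 (by positivity) ?_
  rw [mul_pow, norm_one_add_i_sq hi]
  norm_num

/-- **The key absolute value**: `‖(1 + u) − (1 − u)·i‖ = ‖1 − i‖` for `‖u‖ ≤ 1`, `‖1 − u‖ = 1`, since
`(1 + u) − (1 − u)i = 2u + (1 − u)(1 − i)` with `‖2u‖ ≤ ½ < ‖1 − i‖ = ‖(1 − u)(1 − i)‖` ("all triangles are isosceles").
[cite: NeukirchANT1999, Ch. II (4.8)] -/
theorem norm_keyPlus [IsUltrametricDist K] (hi : i ^ 2 = -1) (hu : ‖u‖ ≤ 1) (h1u : ‖1 - u‖ = 1) :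
    ‖(1 + u) - (1 - u) * i‖ = ‖1 - i‖ := by
  have h : (1 + u) - (1 - u) * i = 2 * u + (1 - u) * (1 - i) := by ring
  have hB : ‖(1 - u) * (1 - i)‖ = ‖1 - i‖ := by rw [norm_mul, h1u, one_mul]
  have hA : ‖2 * u‖ < ‖(1 - u) * (1 - i)‖ := by
    rw [hB, norm_mul, WildDyadic.norm_two]
    calc (2 : ℝ)⁻¹ * ‖u‖ ≤ 2⁻¹ * 1 := by gcongr
      _ = 2⁻¹ := mul_one _
      _ < ‖1 - i‖ := two_inv_lt_norm_one_sub_i hi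
  rw [h, IsUltrametricDist.norm_add_eq_max_of_norm_ne_norm hA.ne, max_eq_right hA.le, hB]

/-! ## §2 The two-factor packet `K ⊗_{ℚ₂} K`: the idempotent `x = ½·(1⊗1 − i⊗i)` and its image under `f₀ ⊗ f₁` -/

/-- `⊗(i, i)² = 1` (`i² = −1` in both slots). [cite: Mochizuki2012, IUTchIV Prop. 1.1 p. 9] -/
theorem purePacket_i_i_mul_self (hi : i ^ 2 = -1) :
    purePacket 2 (fun _ : Fin 2 => K) ![i, i] * purePacket 2 (fun _ : Fin 2 => K) ![i, i] = 1 := by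
  have hii : i * i = ((-1 : ℚ_[2])) • (1 : K) := by rw [← sq, hi, neg_one_smul]
  have h : (![((-1 : ℚ_[2])) • (1 : K), ((-1 : ℚ_[2])) • (1 : K)] : Fin 2 → K) =
      fun j => (![(-1 : ℚ_[2]), -1] : Fin 2 → ℚ_[2]) j • (1 : Fin 2 → K) j := by
    funext j
    fin_cases j <;> simp
  rw [WildQuadratic.purePacket_pair_mul, hii, h, purePacket_smul, purePacket_one, Fin.prod_univ_two]
  simp only [Matrix.cons_val_zero, Matrix.cons_val_one]
  rw [show (-1 : ℚ_[2]) * -1 = 1 by norm_num, one_smul]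

/-- **The idempotent** `x = ½·(1 − ⊗(i, i))` of `K ⊗_{ℚ₂} K`: `x² = x` (`(1 − T)² = 2(1 − T)` as `T² = 1`).
[cite: Mochizuki2012, IUTchIV Prop. 1.1 p. 9] -/
theorem gaussIdempotent_mul_self (hi : i ^ 2 = -1) :
    (2 : ℚ_[2])⁻¹ • ((1 : PacketAlgebra 2 (fun _ : Fin 2 => K)) - purePacket 2 (fun _ : Fin 2 => K) ![i, i]) *
        (2 : ℚ_[2])⁻¹ • ((1 : PacketAlgebra 2 (fun _ : Fin 2 => K)) - purePacket 2 (fun _ : Fin 2 => K) ![i, i]) =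
      (2 : ℚ_[2])⁻¹ • ((1 : PacketAlgebra 2 (fun _ : Fin 2 => K)) - purePacket 2 (fun _ : Fin 2 => K) ![i, i]) := by
  set T := purePacket 2 (fun _ : Fin 2 => K) ![i, i]
  have hW : (1 - T) * (1 - T) = 2 * (1 - T) := by
    linear_combination purePacket_i_i_mul_self hi
  have h2 : (2 : PacketAlgebra 2 (fun _ : Fin 2 => K)) * (1 - T) = (2 : ℚ_[2]) • (1 - T) := by
    rw [Algebra.smul_def, map_ofNat]
  rw [smul_mul_smul_comm, hW, h2, smul_smul, show (2 : ℚ_[2])⁻¹ * 2⁻¹ * 2 = 2⁻¹ by norm_num]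

/-- `x ∈ (R_I)^∼`: an idempotent is integral (root of `X² − X`). [cite: Mochizuki2012, IUTchIV Prop. 1.1 p. 9] -/
theorem gaussIdempotent_mem_normalizedPacket (hi : i ^ 2 = -1) :
    (2 : ℚ_[2])⁻¹ • ((1 : PacketAlgebra 2 (fun _ : Fin 2 => K)) - purePacket 2 (fun _ : Fin 2 => K) ![i, i]) ∈
      normalizedPacket 2 (fun _ : Fin 2 => K) := by
  rw [mem_normalizedPacket_iff]
  refine ⟨Polynomial.X * (Polynomial.X - Polynomial.C 1),
    Polynomial.monic_X.mul (Polynomial.monic_X_sub_C 1), ?_⟩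
  rw [Polynomial.eval₂_mul, Polynomial.eval₂_sub, Polynomial.eval₂_X, Polynomial.eval₂_C, map_one,
    mul_sub, mul_one, gaussIdempotent_mul_self hi, sub_self]

/-- **`(f₀ ⊗ f₁)(x) = ½·(1⊗1 − (1 − u + u i)⊗i)`** for ANY `ℚ₂`-linear `f₀`, `f₁` with `f₀ 1 = 1`, `f₀ i = 1 − u + u·i` (the
unit twist: `f₀ (1 − i) = u·(1 − i)`) and `f₁` fixing `1, i`. [cite: Mochizuki2012, IUTchIV Prop. 1.1 p. 9] -/
theorem congr_pair_gaussIdempotent (f : ∀ _ : Fin 2, K ≃ₗ[ℚ_[2]] K) (h0 : f 0 1 = 1) (h0i : f 0 i = 1 - u + u * i)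
    (h1 : f 1 1 = 1) (h1i : f 1 i = i) :
    (PiTensorProduct.congr f : PacketAlgebra 2 (fun _ : Fin 2 => K) ≃ₗ[ℚ_[2]] PacketAlgebra 2 (fun _ : Fin 2 => K))
        ((2 : ℚ_[2])⁻¹ • ((1 : PacketAlgebra 2 (fun _ : Fin 2 => K)) - purePacket 2 (fun _ : Fin 2 => K) ![i, i])) =
      (2 : ℚ_[2])⁻¹ • ((1 : PacketAlgebra 2 (fun _ : Fin 2 => K)) -
        purePacket 2 (fun _ : Fin 2 => K) ![1 - u + u * i, i]) := by
  have hG1 : (PiTensorProduct.congr f : PacketAlgebra 2 (fun _ : Fin 2 => K) ≃ₗ[ℚ_[2]] PacketAlgebra 2 (fun _ : Fin 2 => K))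
      1 = 1 := by
    rw [← WildQuadratic.purePacket_pair_one, WildQuadratic.congr_pair_purePacket, h0, h1]
  have hGii : (PiTensorProduct.congr f : PacketAlgebra 2 (fun _ : Fin 2 => K) ≃ₗ[ℚ_[2]] PacketAlgebra 2 (fun _ : Fin 2 => K))
      (purePacket 2 (fun _ : Fin 2 => K) ![i, i]) = purePacket 2 (fun _ : Fin 2 => K) ![1 - u + u * i, i] := by
    rw [WildQuadratic.congr_pair_purePacket, h0i, h1i]
  rw [map_smul, map_sub, hG1, hGii]

/-! ## §3 Field-factor coordinates of the twisted idempotent: every one has norm `√2 > 1` -/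

section Coordinates

variable [IsUltrametricDist K] [ProperSpace K]

omit [IsUltrametricDist K] in
/-- A field-factor coordinate of `⊗(x, y)` is the product of the coordinates of `ι₀(x)` and `ι₁(y)`.
[cite: Mochizuki2012, IUTchIV Prop. 1.4 (i) p. 13] -/
theorem dEquiv_purePacket_pair (x y : K) (j : DIdx 2 (fun _ : Fin 2 => K)) :
    dEquiv 2 (fun _ : Fin 2 => K) (purePacket 2 (fun _ : Fin 2 => K) ![x, y]) j =
      dEquiv 2 (fun _ : Fin 2 => K) (iota 2 (fun _ : Fin 2 => K) 0 x) j *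
        dEquiv 2 (fun _ : Fin 2 => K) (iota 2 (fun _ : Fin 2 => K) 1 y) j := by
  rw [WildQuadratic.purePacket_pair_eq_iota_mul, map_mul, Pi.mul_apply]

omit [IsUltrametricDist K] in
/-- In each field factor the two images of `i` agree up to sign: `ψ(ι₁ i)_j = ± ψ(ι₀ i)_j` (both square to `−1` in the
FIELD `L_j`). [cite: Mochizuki2012, IUTchIV Prop. 1.4 (i) p. 13] -/
theorem dEquiv_iota_i_eq_or (hi : i ^ 2 = -1) (j : DIdx 2 (fun _ : Fin 2 => K)) :
    dEquiv 2 (fun _ : Fin 2 => K) (iota 2 (fun _ : Fin 2 => K) 1 i) j =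
        dEquiv 2 (fun _ : Fin 2 => K) (iota 2 (fun _ : Fin 2 => K) 0 i) j ∨
      dEquiv 2 (fun _ : Fin 2 => K) (iota 2 (fun _ : Fin 2 => K) 1 i) j =
        -dEquiv 2 (fun _ : Fin 2 => K) (iota 2 (fun _ : Fin 2 => K) 0 i) j := by
  set I := dEquiv 2 (fun _ : Fin 2 => K) (iota 2 (fun _ : Fin 2 => K) 0 i) j
  set J := dEquiv 2 (fun _ : Fin 2 => K) (iota 2 (fun _ : Fin 2 => K) 1 i) j
  have hsq : ∀ s : Fin 2, dEquiv 2 (fun _ : Fin 2 => K) (iota 2 (fun _ : Fin 2 => K) s i) j ^ 2 = -1 := fun s => by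
    rw [sq, ← Pi.mul_apply, ← map_mul, ← map_mul, ← sq, hi, map_neg, map_one, map_neg, map_one, Pi.neg_apply,
      Pi.one_apply]
  have h : (J - I) * (J + I) = 0 := by
    have hI := hsq 0
    have hJ := hsq 1
    linear_combination hJ - hI
  rcases mul_eq_zero.mp h with h | h
  · exact Or.inl (sub_eq_zero.mp h)
  · exact Or.inr (add_eq_zero_iff_eq_neg.mp h)

/-- **Every field-factor coordinate of the twisted idempotent `½·(1⊗1 − (1 − u + u i)⊗i)` has norm `> 1`** (`= 2‖1 ∓ i‖`):
with `a = ψ(ι₀ ·)_j`, `b = ψ(ι₁ ·)_j`, `b(i) = ±a(i)`, it is `a(½((1+u) − (1−u)i))` resp. `a(½(1−u)(1+i))`, `a` isometric.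
[cite: Mochizuki2012, IUTchIV Prop. 1.4 (i) p. 13] [cite: NeukirchANT1999, Ch. II (4.8)] -/
theorem one_lt_norm_dEquiv_twistedIdempotent (hi : i ^ 2 = -1) (hu : ‖u‖ ≤ 1) (h1u : ‖1 - u‖ = 1)
    (j : DIdx 2 (fun _ : Fin 2 => K)) :
    1 < ‖dEquiv 2 (fun _ : Fin 2 => K) ((2 : ℚ_[2])⁻¹ • ((1 : PacketAlgebra 2 (fun _ : Fin 2 => K)) -
        purePacket 2 (fun _ : Fin 2 => K) ![1 - u + u * i, i])) j‖ := by
  have h2 : ‖(2 : ℚ_[2])‖ = 2⁻¹ := by simpa using Padic.norm_p (p := 2)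
  have h2inv : ‖(2 : ℚ_[2])⁻¹‖ = 2 := by rw [norm_inv, h2, inv_inv]
  have hI : dEquiv 2 (fun _ : Fin 2 => K) (iota 2 (fun _ : Fin 2 => K) 0 i) j ^ 2 = -1 := by
    rw [sq, ← Pi.mul_apply, ← map_mul, ← map_mul, ← sq, hi, map_neg, map_one, map_neg, map_one, Pi.neg_apply,
      Pi.one_apply]
  rw [map_smul, Pi.smul_apply, map_sub (dEquiv 2 (fun _ : Fin 2 => K)), Pi.sub_apply, map_one, Pi.one_apply,
    dEquiv_purePacket_pair]
  rcases dEquiv_iota_i_eq_or (K := K) hi j with hJ | hJ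
  · rw [hJ]
    have hval : (1 : DFac 2 (fun _ : Fin 2 => K) j) -
        dEquiv 2 (fun _ : Fin 2 => K) (iota 2 (fun _ : Fin 2 => K) 0 (1 - u + u * i)) j *
          dEquiv 2 (fun _ : Fin 2 => K) (iota 2 (fun _ : Fin 2 => K) 0 i) j =
        dEquiv 2 (fun _ : Fin 2 => K) (iota 2 (fun _ : Fin 2 => K) 0 ((1 + u) - (1 - u) * i)) j := by
      simp only [map_add, map_sub, map_mul, map_one, Pi.add_apply, Pi.sub_apply, Pi.mul_apply, Pi.one_apply]
      linear_combination (-(dEquiv 2 (fun _ : Fin 2 => K) (iota 2 (fun _ : Fin 2 => K) 0 u) j)) * hI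
    rw [hval, norm_smul, h2inv, norm_dEquiv_iota, norm_keyPlus hi hu h1u]
    exact one_lt_two_mul_norm_one_sub_i hi
  · rw [hJ]
    have hval : (1 : DFac 2 (fun _ : Fin 2 => K) j) -
        dEquiv 2 (fun _ : Fin 2 => K) (iota 2 (fun _ : Fin 2 => K) 0 (1 - u + u * i)) j *
          -dEquiv 2 (fun _ : Fin 2 => K) (iota 2 (fun _ : Fin 2 => K) 0 i) j =
        dEquiv 2 (fun _ : Fin 2 => K) (iota 2 (fun _ : Fin 2 => K) 0 ((1 - u) * (1 + i))) j := by
      simp only [map_add, map_sub, map_mul, map_one, Pi.add_apply, Pi.sub_apply, Pi.mul_apply, Pi.one_apply]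
      linear_combination (dEquiv 2 (fun _ : Fin 2 => K) (iota 2 (fun _ : Fin 2 => K) 0 u) j) * hI
    rw [hval, norm_smul, h2inv, norm_dEquiv_iota, norm_mul, h1u, one_mul]
    exact one_lt_two_mul_norm_one_add_i hi

/-- **The twisted idempotent is NOT in `(R_I)^∼`** (a point of `(R_I)^∼` has all coordinates of norm `≤ 1`).
[cite: Mochizuki2012, IUTchIV Prop. 1.1 p. 9, Prop. 1.4 (i) p. 13] -/
theorem twistedIdempotent_not_mem (hi : i ^ 2 = -1) (hu : ‖u‖ ≤ 1) (h1u : ‖1 - u‖ = 1) :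
    (2 : ℚ_[2])⁻¹ • ((1 : PacketAlgebra 2 (fun _ : Fin 2 => K)) - purePacket 2 (fun _ : Fin 2 => K) ![1 - u + u * i, i]) ∉
      normalizedPacket 2 (fun _ : Fin 2 => K) := by
  intro hmem
  obtain ⟨j⟩ := nonempty_dIdx 2 (fun _ : Fin 2 => K)
  have h1 := norm_dEquiv_le_one_of_mem_normalizedPacket 2 (fun _ : Fin 2 => K) hmem j
  exact not_lt.mpr h1 (one_lt_norm_dEquiv_twistedIdempotent hi hu h1u j)

/-- **`(f₀ ⊗ f₁)(x) ∉ (R_I)^∼`** for the idempotent `x = ½·(1⊗1 − i⊗i)` and any `f₀, f₁` with `f₀ 1 = 1`, `f₀ i = 1 − u + u i`,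
`f₁ 1 = 1`, `f₁ i = i`. [cite: Mochizuki2012, IUTchIV Prop. 1.1 p. 9, Prop. 1.4 (i) p. 13] -/
theorem congr_pair_gaussIdempotent_not_mem (hi : i ^ 2 = -1) (hu : ‖u‖ ≤ 1) (h1u : ‖1 - u‖ = 1)
    (f : ∀ _ : Fin 2, K ≃ₗ[ℚ_[2]] K) (h0 : f 0 1 = 1) (h0i : f 0 i = 1 - u + u * i) (h1 : f 1 1 = 1) (h1i : f 1 i = i) :
    (PiTensorProduct.congr f : PacketAlgebra 2 (fun _ : Fin 2 => K) ≃ₗ[ℚ_[2]] PacketAlgebra 2 (fun _ : Fin 2 => K))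
        ((2 : ℚ_[2])⁻¹ • ((1 : PacketAlgebra 2 (fun _ : Fin 2 => K)) - purePacket 2 (fun _ : Fin 2 => K) ![i, i])) ∉
      normalizedPacket 2 (fun _ : Fin 2 => K) := by
  rw [congr_pair_gaussIdempotent f h0 h0i h1 h1i]
  exact twistedIdempotent_not_mem hi hu h1u

/-- **`f₀ ⊗ f₁` moves a point of `(R_I)^∼` out of `(R_I)^∼`** (the idempotent `x`). [cite: Mochizuki2012, IUTchIV Prop. 1.1 p. 9] -/
theorem exists_mem_normalizedPacket_congr_not_mem (hi : i ^ 2 = -1) (hu : ‖u‖ ≤ 1) (h1u : ‖1 - u‖ = 1)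
    (f : ∀ _ : Fin 2, K ≃ₗ[ℚ_[2]] K) (h0 : f 0 1 = 1) (h0i : f 0 i = 1 - u + u * i) (h1 : f 1 1 = 1) (h1i : f 1 i = i) :
    ∃ z : PacketAlgebra 2 (fun _ : Fin 2 => K),
      z ∈ (normalizedPacket 2 (fun _ : Fin 2 => K) : Set (PacketAlgebra 2 (fun _ : Fin 2 => K))) ∧
        (PiTensorProduct.congr f : PacketAlgebra 2 (fun _ : Fin 2 => K) ≃ₗ[ℚ_[2]] PacketAlgebra 2 (fun _ : Fin 2 => K)) z ∉
          (normalizedPacket 2 (fun _ : Fin 2 => K) : Set (PacketAlgebra 2 (fun _ : Fin 2 => K))) :=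
  ⟨_, gaussIdempotent_mem_normalizedPacket (K := K) hi, congr_pair_gaussIdempotent_not_mem hi hu h1u f h0 h0i h1 h1i⟩

/-- **Hence `f₀ ⊗ f₁` does NOT map `(R_I)^∼` onto itself.** [cite: Mochizuki2012, IUTchIV Prop. 1.1 p. 9] -/
theorem congr_image_normalizedPacket_ne (hi : i ^ 2 = -1) (hu : ‖u‖ ≤ 1) (h1u : ‖1 - u‖ = 1)
    (f : ∀ _ : Fin 2, K ≃ₗ[ℚ_[2]] K) (h0 : f 0 1 = 1) (h0i : f 0 i = 1 - u + u * i) (h1 : f 1 1 = 1) (h1i : f 1 i = i) :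
    (PiTensorProduct.congr f : PacketAlgebra 2 (fun _ : Fin 2 => K) ≃ₗ[ℚ_[2]] PacketAlgebra 2 (fun _ : Fin 2 => K)) ''
        (normalizedPacket 2 (fun _ : Fin 2 => K) : Set (PacketAlgebra 2 (fun _ : Fin 2 => K))) ≠
      (normalizedPacket 2 (fun _ : Fin 2 => K) : Set (PacketAlgebra 2 (fun _ : Fin 2 => K))) := by
  intro h
  obtain ⟨z, hz, hnot⟩ := exists_mem_normalizedPacket_congr_not_mem hi hu h1u f h0 h0i h1 h1i
  exact hnot (h ▸ Set.mem_image_of_mem _ hz)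

end Coordinates

/-! ## §4 Isometric realisation: the unit twist on `K = W₀ ⊕ W₀·(1 − i)`, `‖W₀ ∖ 0‖ ⊆ 2^ℤ` -/

section Isometry

variable [IsUltrametricDist K]

omit [IsUltrametricDist K] in
/-- An integral and a half-integral power of `2` never tie: `2^n ≠ 2^m·‖1 − i‖`. [cite: NeukirchANT1999, Ch. II (5.5)] -/
theorem zpow_ne_zpow_mul_norm_one_sub_i (hi : i ^ 2 = -1) (n m : ℤ) : (2 : ℝ) ^ n ≠ 2 ^ m * ‖1 - i‖ := by
  intro h
  have h2ne : (2 : ℝ) ≠ 0 := by norm_num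
  have hπ : ‖1 - i‖ = 2 ^ (n - m) := by
    rw [zpow_sub₀ h2ne, eq_div_iff (zpow_ne_zero m h2ne), mul_comm]
    exact h.symm
  have h3 : (2 : ℝ) ^ ((n - m) * 2 + 1) = (2 : ℝ) ^ (0 : ℤ) := by
    rw [zpow_add₀ h2ne, zpow_mul, ← hπ, zpow_one, zpow_zero, zpow_two, ← sq, norm_one_sub_i_sq hi]
    norm_num
  have h4 := (zpow_right_inj₀ (by norm_num : (0 : ℝ) < 2) (by norm_num : (2 : ℝ) ≠ 1)).mp h3
  omega

/-- **PARITY**: `‖a + b·(1 − i)‖ = max(‖a‖, ‖b‖·‖1 − i‖)` whenever `‖a‖, ‖b‖ ∈ 2^ℤ ∪ {0}`.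
[cite: NeukirchANT1999, Ch. II (5.5)] [cite: WeilBNT1967, Ch. II §1, Prop. 2–3] -/
theorem norm_add_mul_eq_max_of_zpow (hi : i ^ 2 = -1) {a b : K} (ha : a = 0 ∨ ∃ n : ℤ, ‖a‖ = 2 ^ n)
    (hb : b = 0 ∨ ∃ n : ℤ, ‖b‖ = 2 ^ n) : ‖a + b * (1 - i)‖ = max ‖a‖ (‖b‖ * ‖1 - i‖) := by
  rw [← norm_mul]
  refine WildCubic.norm_add_eq_max_of a (b * (1 - i)) ?_
  rcases ha with rfl | ⟨n, hn⟩
  · exact Or.inl rfl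
  rcases hb with rfl | ⟨m, hm⟩
  · exact Or.inr (Or.inl (zero_mul _))
  · refine Or.inr (Or.inr ?_)
    rw [hn, norm_mul, hm]
    exact zpow_ne_zpow_mul_norm_one_sub_i hi n m

/-- Uniqueness of the decomposition `a + b·(1 − i)` (`a, b ∈ W₀`). [cite: WeilBNT1967, Ch. II §1, Prop. 2–3] -/
theorem eq_of_add_mul_eq (hi : i ^ 2 = -1) {W₀ : Submodule ℚ_[2] K} (hW : ∀ a ∈ W₀, a = 0 ∨ ∃ n : ℤ, ‖a‖ = 2 ^ n)
    {a b a' b' : K} (ha : a ∈ W₀) (hb : b ∈ W₀) (ha' : a' ∈ W₀) (hb' : b' ∈ W₀)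
    (h : a + b * (1 - i) = a' + b' * (1 - i)) : a = a' ∧ b = b' := by
  have hd : (a - a') + (b - b') * (1 - i) = 0 := by rw [← sub_eq_zero.mpr h]; ring
  have hmax := norm_add_mul_eq_max_of_zpow hi (hW _ (W₀.sub_mem ha ha')) (hW _ (W₀.sub_mem hb hb'))
  rw [hd, norm_zero] at hmax
  have h1 : ‖a - a'‖ = 0 := le_antisymm (le_of_max_le_left hmax.ge) (norm_nonneg _)
  have hπ : 0 < ‖1 - i‖ := lt_trans (by norm_num) (two_inv_lt_norm_one_sub_i hi)
  have h2 : ‖b - b'‖ = 0 := by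
    have h := le_antisymm (le_of_max_le_right hmax.ge) (mul_nonneg (norm_nonneg _) hπ.le)
    rcases mul_eq_zero.mp h with h | h
    · exact h
    · exact absurd h hπ.ne'
  exact ⟨sub_eq_zero.mp (norm_eq_zero.mp h1), sub_eq_zero.mp (norm_eq_zero.mp h2)⟩

/-- **THE UNIT TWIST IS AN ISOMETRY on `K = W₀ ⊕ W₀·(1 − i)`** (`W₀ ∋ 1` a `ℚ₂`-subspace with `‖W₀ ∖ 0‖ ⊆ 2^ℤ`, `‖u‖ = 1`):
a `ℚ₂`-linear automorphism `g` (`id` on `W₀`, `× u` on `W₀(1 − i)`) with `g 1 = 1`, `g i = 1 − u + u·i`, `‖g x‖ = ‖x‖` (parity).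
The class `e(K | ℚ₂(√−1)) = 1`, any residue degree. [cite: WeilBNT1967, Ch. II §1, Prop. 2–3] [cite: NeukirchANT1999, Ch. II (5.5)] -/
theorem exists_unitTwist_isometry [ProperSpace K] (hi : i ^ 2 = -1) (W₀ : Submodule ℚ_[2] K)
    (hW : ∀ a ∈ W₀, a = 0 ∨ ∃ n : ℤ, ‖a‖ = 2 ^ n) (h1 : (1 : K) ∈ W₀)
    (hsp : ∀ x : K, ∃ a ∈ W₀, ∃ b ∈ W₀, x = a + b * (1 - i)) (hu : ‖u‖ = 1) :
    ∃ g : K ≃ₗ[ℚ_[2]] K, g 1 = 1 ∧ g i = 1 - u + u * i ∧ ∀ x, ‖g x‖ = ‖x‖ := by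
  classical
  haveI : FiniteDimensional ℚ_[2] K := FiniteDimensional.of_locallyCompactSpace ℚ_[2]
  choose α hα β hβ hx using hsp
  have huniq : ∀ x a b, a ∈ W₀ → b ∈ W₀ → x = a + b * (1 - i) → α x = a ∧ β x = b :=
    fun x a b ha hb h => eq_of_add_mul_eq hi hW (hα x) (hβ x) ha hb ((hx x).symm.trans h)
  let g₀ : K →ₗ[ℚ_[2]] K :=
    { toFun := fun x => α x + u * β x * (1 - i)
      map_add' := fun x y => by
        have e : x + y = (α x + α y) + (β x + β y) * (1 - i) := by
          calc x + y = (α x + β x * (1 - i)) + (α y + β y * (1 - i)) := by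
                conv_lhs => rw [hx x, hx y]
            _ = (α x + α y) + (β x + β y) * (1 - i) := by ring
        have h := huniq (x + y) _ _ (W₀.add_mem (hα x) (hα y)) (W₀.add_mem (hβ x) (hβ y)) e
        show α (x + y) + u * β (x + y) * (1 - i) = (α x + u * β x * (1 - i)) + (α y + u * β y * (1 - i))
        rw [h.1, h.2]
        ring
      map_smul' := fun c x => by
        have e : c • x = c • α x + (c • β x) * (1 - i) := by
          calc c • x = c • (α x + β x * (1 - i)) := by
                conv_lhs => rw [hx x]
            _ = c • α x + (c • β x) * (1 - i) := by rw [smul_add, smul_mul_assoc]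
        have h := huniq (c • x) _ _ (W₀.smul_mem c (hα x)) (W₀.smul_mem c (hβ x)) e
        show α (c • x) + u * β (c • x) * (1 - i) = (RingHom.id ℚ_[2]) c • (α x + u * β x * (1 - i))
        rw [RingHom.id_apply, h.1, h.2, smul_add, mul_smul_comm, smul_mul_assoc] }
  have hg₀ : ∀ x, g₀ x = α x + u * β x * (1 - i) := fun x => rfl
  have hiso : ∀ x, ‖g₀ x‖ = ‖x‖ := by
    intro x
    have hub : u * β x = 0 ∨ ∃ n : ℤ, ‖u * β x‖ = 2 ^ n := by
      rcases hW _ (hβ x) with h | ⟨n, hn⟩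
      · exact Or.inl (by rw [h, mul_zero])
      · exact Or.inr ⟨n, by rw [norm_mul, hu, one_mul, hn]⟩
    rw [hg₀, norm_add_mul_eq_max_of_zpow hi (hW _ (hα x)) hub, norm_mul, hu, one_mul]
    conv_rhs => rw [hx x]
    rw [norm_add_mul_eq_max_of_zpow hi (hW _ (hα x)) (hW _ (hβ x))]
  have hinj : Function.Injective g₀ := by
    intro x y hxy
    have h : g₀ (x - y) = 0 := by rw [map_sub, hxy, sub_self]
    have h' : ‖x - y‖ = 0 := by rw [← hiso, h, norm_zero]
    exact sub_eq_zero.mp (norm_eq_zero.mp h')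
  let g : K ≃ₗ[ℚ_[2]] K := LinearEquiv.ofBijective g₀ ⟨hinj, LinearMap.surjective_of_injective hinj⟩
  have hg : ∀ x, g x = g₀ x := fun x => rfl
  have hα1 := huniq 1 1 0 h1 W₀.zero_mem (by ring)
  have hαπ := huniq (1 - i) 0 1 W₀.zero_mem h1 (by ring)
  refine ⟨g, ?_, ?_, fun x => by rw [hg, hiso]⟩
  · rw [hg, hg₀, hα1.1, hα1.2]
    ring
  · have h : i = 1 - (1 - i) := by ring
    rw [h, map_sub, hg, hg, hg₀, hg₀, hα1.1, hα1.2, hαπ.1, hαπ.2]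
    ring

/-- **WILD GAUSSIAN ISOMETRY MOVER (basis-free form)**, in the shape of `WildCubicIsometryMover.exists_isometry_maxOrder_mover`:
an ISOMETRY `f₀` of `K` (mapping `𝒪_K`, every `𝔪^n` onto themselves) and `z ∈ (R_I)^∼` of `K ⊗_{ℚ₂} K` with `(f₀ ⊗ 1) z ∉ (R_I)^∼`.
[cite: Mochizuki2012, IUTchIV Prop. 1.1 p. 9] [cite: NeukirchANT1999, Ch. II (5.5)] [cite: WeilBNT1967, Ch. II §1, Prop. 2–3] -/
theorem exists_isometry_maxOrder_mover [ProperSpace K] (hi : i ^ 2 = -1) (W₀ : Submodule ℚ_[2] K)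
    (hW : ∀ a ∈ W₀, a = 0 ∨ ∃ n : ℤ, ‖a‖ = 2 ^ n) (h1 : (1 : K) ∈ W₀)
    (hsp : ∀ x : K, ∃ a ∈ W₀, ∃ b ∈ W₀, x = a + b * (1 - i)) (hu : ‖u‖ = 1) (h1u : ‖1 - u‖ = 1) :
    ∃ f₀ : K ≃ₗ[ℚ_[2]] K, (∀ x, ‖f₀ x‖ = ‖x‖) ∧ (∀ r : ℝ, f₀ '' closedBall (0 : K) r = closedBall 0 r) ∧
      ∃ z : PacketAlgebra 2 (fun _ : Fin 2 => K),
        z ∈ (normalizedPacket 2 (fun _ : Fin 2 => K) : Set (PacketAlgebra 2 (fun _ : Fin 2 => K))) ∧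
          (PiTensorProduct.congr (![f₀, LinearEquiv.refl ℚ_[2] K] : ∀ _ : Fin 2, K ≃ₗ[ℚ_[2]] K) :
              PacketAlgebra 2 (fun _ : Fin 2 => K) ≃ₗ[ℚ_[2]] PacketAlgebra 2 (fun _ : Fin 2 => K)) z ∉
            (normalizedPacket 2 (fun _ : Fin 2 => K) : Set (PacketAlgebra 2 (fun _ : Fin 2 => K))) := by
  obtain ⟨f₀, h0, h0i, hiso⟩ := exists_unitTwist_isometry (K := K) hi W₀ hW h1 hsp hu
  exact ⟨f₀, hiso, image_closedBall_eq_of_norm_map_eq 2 f₀ hiso,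
    exists_mem_normalizedPacket_congr_not_mem hi hu.le h1u _ h0 h0i rfl rfl⟩

end Isometry

end WildGaussian

end Literature.IUT.LogVolume

end
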